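import Summits.CriticalPhenomena.PercolationContinuityZ3.Theorems.PercNearOneGluingNoHeavyLowerTailSahiAllButCPolya
import Summits.CriticalPhenomena.PercolationContinuityZ3.Theorems.PercNearOneGluingNoHeavyLowerTailSahiCTCSignature
import Summits.CriticalPhenomena.PercolationContinuityZ3.Theorems.PercNearOneGluingNoHeavyLowerTailSahiAllButThreeFive

/-!
# `NoHeavyLowerTail` (crux stmt-CriticalPhenomena-4575), Sahi / Kahn positivity: ROW (a) OF THE LEVEL-3 THRESHOLD CERTIFICATE
# FOR EVERY `k` — the Pólya certificate (A3Π) `Π·(Π·e₃ − Θ₂·D₃) ∈ ℕ[r]`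

Support file (cell `prim-l12`, seat P3, gen 22; `--supports stmt-CriticalPhenomena-4575`).  No `sorry`, no named facts,
standard axioms.  Memo `run/shared/lean/prim/prim-l12/FROM-prim-l12-p3-g22-*.md` (and g21 §8 for the statement).

`…SahiAllButC.rhoCert_allBut` (gen 21) makes `ρ_c = μ(· | exactly c closed)` a reduced transport certificate of the level-`c`
threshold pattern event `allBut c k = Th_{k−c}^k` under TWO hypotheses at the odds vector `r`: row (a)
`Θ_c·D_c ≤ (Π + D_c)·e_c` (probabilistically `P(N ≤ c−1)·P(N ≥ c+1) ≤ P(N = c)` for the number `N` of closed coordinates) and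
the (TC) row `Ñ_c ≥ 0`.  For `c = 2` row (a) holds COEFFICIENTWISE for every `k` (`…SahiAllButTwoRowA`); for `c = 3` it does
NOT (`F₃ := Π·e₃ − Θ₂·D₃` has coefficient `−2` at every squarefree degree-6 monomial), and on five coordinates it was a table
check (`…SahiAllButThreeFive`).  `…SahiAllButCPolya` reduced row (a)_c for every `k` to a PÓLYA CERTIFICATE `Π·F_c ∈ ℕ[r]`.
THIS FILE proves that certificate for `c = 3` on every finite ground type, by hand:

* `coeff_PiE_sub_ThD` : the coefficient of `X_c = Π·e_c − Θ_{c−1}·D_c` at a profile with `w` single and `d` doubled points is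
  the SIGNATURE VALUE `B_c(w, d) = posN − negN = [d ≤ c]·C(w, c−d) − Σ_{i < c−d} [c < d + w − i]·C(w, i)` (unconstrained profile
  pairs `(P, S)` ↔ subsets `T = P ∖ D` of the single points, `card_pairs_univ_eq`);
* `sigB_three_nonneg` / `sigB_three_neg` : `B₃(w, d) ≥ 0` except `B₃(6, 0) = −2` (and `B₃(5,1) = B₃(5,0) = 4`, `B₃(7,0) = 6`);
* `coeff_PiP_mul_X3_nonneg` : **(A3Π) `Π·X₃ ∈ ℕ[r]`**.  The coefficient at `n` is `Σ_{P ⊆ supp n} B₃(signature of n − 1_P)`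
  (`coeff_gf_mul`, `signature_tsub_ind`).  A negative term forces `n ≤ 2` pointwise and `P ⊇ V₂` (the doubled points of `n`).
  If `V₂ ∋ y₀` is nonempty, `P ↦ P.erase y₀` injects the negative terms (`−2`) into terms of signature `(5, 1)` (`= 4`); if `n`
  is squarefree on `a` points the terms of signatures `(5,0), (6,0), (7,0)` contribute `4·C(a,5) − 2·C(a,6) + 6·C(a,7) ≥ 0`
  (`two_choose_six_le`: `C(a,6) ≤ 2C(a,5)` for `a ≤ 17`, `C(a,6) ≤ 3C(a,7)` for `a ≥ 9`) and all other terms are `≥ 0`;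
* `coeff_PiP_mul_aPoly3_nonneg`, `aRow3` : row (a) of the level-3 certificate at the odds of EVERY interior parameter vector on
  every number `k` of coordinates — `P(N ≤ 2)·P(N ≥ 4) ≤ P(N = 3)` for every Poisson-binomial `N`;
* `rhoCert_allButThree_of_N3`, `sahiE_three_nonneg_of_allButThree_of_N3` : the gen-21 level-3 theorems with (a) DISCHARGED —
  for every `k ≥ 3`, Kahn's Conjecture 5 / Sahi's `C₃` for the first slot "at most three of `k` closed" follows from
  `Ñ₃(K_𝒳,K_𝒵)(r) ≥ 0` ALONE (the coefficientwise certificate conjecture CTC₃ gives this for every `k`).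
Nothing is asserted about the crux; `c = 4` (where `B₄` is negative at three signatures) is not treated here.
-/
noncomputable section

open scoped Classical

namespace Summit.CriticalPhenomena.PercolationContinuityZ3.Theorems

namespace SahiAllButC

open Finset MvPolynomial
open SahiHittingSlot SahiTransportCert SahiAllButOne SahiAllButTwo SahiCTCForms SahiCTCGenFun SahiCTCWeightedLYM

/-! ### The values of `B₃` -/

/-- `B₃(6,0) = −2` (the only negative value of `B₃`: `C(6,3) = 20 < 22 = 1 + 6 + 15`). [this work] -/
theorem sigB_three_6_0 : sigB 3 6 0 = -2 := by decide

/-- `B₃(5,1) = 4`. [this work] -/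
theorem sigB_three_5_1 : sigB 3 5 1 = 4 := by decide

/-- `B₃(5,0) = 4`. [this work] -/
theorem sigB_three_5_0 : sigB 3 5 0 = 4 := by decide

/-- `B₃(7,0) = 6`. [this work] -/
theorem sigB_three_7_0 : sigB 3 7 0 = 6 := by decide

/-- **`B₃(w, d) ≥ 0` except at `(w, d) = (6, 0)`.** [this work] -/
theorem sigB_three_nonneg {w d : ℕ} (hne : ¬(w = 6 ∧ d = 0)) : 0 ≤ sigB 3 w d := by
  unfold sigB posN negN
  rcases Nat.lt_or_ge d 3 with hd | hd
  · interval_cases d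
    · -- `d = 0`: `C(w,3) − ([4 ≤ w] + [5 ≤ w]·w + [6 ≤ w]·C(w,2))`
      rcases Nat.lt_or_ge w 7 with hw | hw
      · interval_cases w <;> simp_all <;> decide
      · obtain ⟨v, rfl⟩ : ∃ v, w = v + 7 := ⟨w - 7, by omega⟩
        have e3 : (v + 7).choose 3 * 3 = (v + 7).choose 2 * (v + 5) := by
          have := Nat.choose_succ_right_eq (v + 7) 2
          rw [show v + 7 - 2 = v + 5 by omega] at this; exact this
        have e2 : (v + 7).choose 2 * 2 = (v + 7) * (v + 6) := by
          have := Nat.choose_succ_right_eq (v + 7) 1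
          rw [Nat.choose_one_right, show v + 7 - 1 = v + 6 by omega] at this; exact this
        have h3 : ((v + 7).choose 3 : ℤ) * 3 = ((v + 7).choose 2 : ℤ) * (v + 5) := by exact_mod_cast e3
        have h2 : ((v + 7).choose 2 : ℤ) * 2 = (v + 7 : ℤ) * (v + 6) := by exact_mod_cast e2
        simp only [Finset.sum_range_succ, Finset.sum_range_zero, zero_add, Nat.choose_zero_right, Nat.choose_one_right,
          show (3 : ℕ) - 0 = 3 from rfl, if_pos (show 0 ≤ 3 from Nat.zero_le _)]
        split_ifs <;> try omega
        push_cast; nlinarith [h3, h2]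
    · -- `d = 1`: `C(w,2) − ([3 ≤ w] + [4 ≤ w]·w)`
      rcases Nat.lt_or_ge w 4 with hw | hw
      · interval_cases w <;> decide
      · obtain ⟨v, rfl⟩ : ∃ v, w = v + 4 := ⟨w - 4, by omega⟩
        have e2 : (v + 4).choose 2 * 2 = (v + 4) * (v + 3) := by
          have := Nat.choose_succ_right_eq (v + 4) 1
          rw [Nat.choose_one_right, show v + 4 - 1 = v + 3 by omega] at this; exact this
        have h2 : ((v + 4).choose 2 : ℤ) * 2 = (v + 4 : ℤ) * (v + 3) := by exact_mod_cast e2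
        simp only [Finset.sum_range_succ, Finset.sum_range_zero, zero_add, Nat.choose_zero_right, Nat.choose_one_right,
          show (3 : ℕ) - 1 = 2 from rfl, if_pos (show 1 ≤ 3 by norm_num)]
        split_ifs <;> try omega
        push_cast; nlinarith [h2]
    · -- `d = 2`: `w − [2 ≤ w]`
      simp only [Finset.sum_range_succ, Finset.sum_range_zero, zero_add, Nat.choose_zero_right, Nat.choose_one_right,
        show (3 : ℕ) - 2 = 1 from rfl, if_pos (show 2 ≤ 3 by norm_num)]
      split_ifs <;> push_cast <;> omega
  · -- `d ≥ 3`: no negative pairs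
    rw [show 3 - d = 0 by omega, Finset.sum_range_zero]
    split_ifs <;> simp

/-- `B₃(w, d) < 0` forces `(w, d) = (6, 0)`. [this work] -/
theorem sigB_three_neg {w d : ℕ} (h : sigB 3 w d < 0) : w = 6 ∧ d = 0 := by
  by_contra hne
  exact absurd h (not_lt.2 (sigB_three_nonneg hne))

/-- The binomial inequality closing the squarefree case: `2·C(a,6) ≤ 4·C(a,5) + 6·C(a,7)` for every `a`
(`a ≤ 17`: `C(a,6) ≤ 2·C(a,5)`; `a ≥ 9`: `C(a,6) ≤ 3·C(a,7)`). [this work] -/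
theorem two_choose_six_le (a : ℕ) : 2 * a.choose 6 ≤ 4 * a.choose 5 + 6 * a.choose 7 := by
  rcases Nat.lt_or_ge a 6 with h | h
  · rw [Nat.choose_eq_zero_of_lt h]; omega
  · obtain ⟨b, rfl⟩ : ∃ b, a = b + 6 := ⟨a - 6, by omega⟩
    have h1 : (b + 6).choose 6 * 6 = (b + 6).choose 5 * (b + 1) := by
      have := Nat.choose_succ_right_eq (b + 6) 5
      rw [show b + 6 - 5 = b + 1 by omega] at this; exact this
    have h2 : (b + 6).choose 7 * 7 = (b + 6).choose 6 * b := by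
      have := Nat.choose_succ_right_eq (b + 6) 6
      rw [show b + 6 - 6 = b by omega] at this; exact this
    rcases Nat.lt_or_ge b 12 with hb | hb
    · have : (b + 6).choose 6 * 6 ≤ (b + 6).choose 5 * 12 := by rw [h1]; exact Nat.mul_le_mul_left _ (by omega)
      omega
    · have : (b + 6).choose 6 * 12 ≤ (b + 6).choose 7 * 7 := by rw [h2]; exact Nat.mul_le_mul_left _ hb
      omega

/-! ### The main theorem -/

section Main

variable {α : Type*} [DecidableEq α] [Fintype α]

/-- **(A3Π): `Π·(Π·e₃ − Θ₂·D₃) ∈ ℕ[r]` on every finite ground type** — the Pólya certificate for row (a) of the level-3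
threshold certificate.  Proof: the coefficient at `n` is `Σ_{P ⊆ supp n} B₃(signature of n − 1_P)`; `B₃ ≥ 0` except `B₃(6,0) = −2`;
a negative term forces `n ≤ 2`; if `n` has a doubled point `y₀`, `P ↦ P.erase y₀` injects the negative terms into terms
`B₃(5,1) = 4`; if `n` is squarefree on `a` points the sum is `Σ_j C(a,j)B₃(j,0) ≥ 4C(a,5) − 2C(a,6) + 6C(a,7) ≥ 0`. [this work] -/
theorem coeff_PiP_mul_X3_nonneg (n : α →₀ ℕ) : 0 ≤ (PiP * (PiP * ee 3 - ThC 2 * DdC 3) : MvPolynomial α ℤ).coeff n := by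
  set X := (PiP * ee 3 - ThC 2 * DdC 3 : MvPolynomial α ℤ) with hX
  rw [show (PiP : MvPolynomial α ℤ) = gf univ.powerset from rfl, coeff_gf_mul]
  set S := (univ.powerset : Finset (Finset α)).filter (fun P => ind P ≤ n) with hS
  set f : Finset α → ℤ := fun P => X.coeff (n - ind P) with hf
  show 0 ≤ ∑ P ∈ S, f P
  by_cases hall : ∀ P ∈ S, 0 ≤ f P
  · exact sum_nonneg hall
  push Not at hall
  obtain ⟨P₀, hP₀S, hP₀⟩ := hall
  -- the value of `f` at a sub-profile, and what negativity forces
  have hfval : ∀ P, f P = if (∀ i, (n - ind P) i ≤ 2) then sigB 3 (#(n - ind P).support - #(dbl (n - ind P))) #(dbl (n - ind P))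
      else 0 := fun P => coeff_PiE_sub_ThD 2 (n - ind P)
  have hneg : ∀ P, f P < 0 → (∀ i, (n - ind P) i ≤ 2) ∧ #(n - ind P).support - #(dbl (n - ind P)) = 6 ∧ #(dbl (n - ind P)) = 0 := by
    intro P hP
    rw [hfval P] at hP
    split_ifs at hP with h2
    · exact ⟨h2, sigB_three_neg hP⟩
    · exact absurd hP (lt_irrefl 0)
  -- `n ≤ 2` pointwise
  have hn2 : ∀ i, n i ≤ 2 := by
    obtain ⟨h2, -, hd⟩ := hneg P₀ hP₀
    intro i
    have hdi : (n - ind P₀) i ≠ 2 := by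
      intro h
      have : i ∈ dbl (n - ind P₀) := mem_filter.2 ⟨Finsupp.mem_support_iff.2 (by omega), h⟩
      rw [card_eq_zero.1 hd] at this
      exact notMem_empty _ this
    have := h2 i
    rw [tsub_ind_apply] at this hdi
    split_ifs at this hdi <;> omega
  set V₂ := dbl n with hV₂
  set V₁ := n.support \ dbl n with hV₁
  have hSsub : ∀ P ∈ S, P ⊆ n.support := fun P hP => (ind_le_iff_subset_support P n).1 (mem_filter.1 hP).2
  have hfP : ∀ P ∈ S, f P = sigB 3 (#(V₁ \ P) + #(V₂ ∩ P)) #(V₂ \ P) := by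
    intro P hP
    obtain ⟨h2, hd, hw⟩ := signature_tsub_ind hn2 P
    rw [hfval P, if_pos h2, hw, hd]
  -- the negative terms
  set Bad := S.filter (fun P => f P < 0) with hBad
  have hBadP : ∀ P ∈ Bad, V₂ ⊆ P ∧ #(V₁ \ P) + #V₂ = 6 ∧ f P = -2 := by
    intro P hP
    obtain ⟨hPS, hPf⟩ := mem_filter.1 hP
    rw [hfP P hPS] at hPf ⊢
    obtain ⟨hw, hd⟩ := sigB_three_neg hPf
    have hV2P : V₂ ⊆ P := sdiff_eq_empty_iff_subset.1 (card_eq_zero.1 hd)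
    have hint : V₂ ∩ P = V₂ := inter_eq_left.2 hV2P
    rw [hint] at hw
    refine ⟨hV2P, hw, ?_⟩
    rw [hint, hw, hd, sigB_three_6_0]
  have hout : ∀ P ∈ S, P ∉ Bad → 0 ≤ f P := fun P hPS hPB => by
    by_contra h; push Not at h; exact hPB (mem_filter.2 ⟨hPS, h⟩)
  rcases V₂.eq_empty_or_nonempty with hV2e | ⟨y₀, hy₀⟩
  · -- squarefree `n`: `f P = B₃(#N − #P, 0)` for `P ⊆ N`
    have hV1N : V₁ = n.support := by rw [hV₁, ← hV₂, hV2e, sdiff_empty]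
    have hfB : ∀ P ∈ S, f P = sigB 3 (#n.support - #P) 0 := by
      intro P hP
      rw [hfP P hP, hV2e, hV1N, empty_inter, empty_sdiff, card_empty, add_zero, card_sdiff_of_subset (hSsub P hP)]
    set G : ℕ → Finset (Finset α) := fun j => S.filter (fun P => #n.support - #P = j) with hG
    have hGcard : ∀ j, #(G j) = (#n.support).choose j := by
      intro j
      have hGj : G j = (n.support.powersetCard (#n.support - j)).filter (fun _ => j ≤ #n.support) := by
        ext P
        simp only [hG, hS, mem_filter, mem_powerset, mem_powersetCard, subset_univ, true_and, ind_le_iff_subset_support]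
        constructor
        · rintro ⟨hPN, hj⟩
          have := card_le_card hPN
          exact ⟨⟨hPN, by omega⟩, by omega⟩
        · rintro ⟨⟨hPN, hc⟩, hj⟩
          exact ⟨hPN, by omega⟩
      rw [hGj]
      by_cases hj : j ≤ #n.support
      · rw [filter_true_of_mem fun _ _ => hj, card_powersetCard, Nat.choose_symm hj]
      · rw [filter_false_of_mem fun _ _ => hj, card_empty, Nat.choose_eq_zero_of_lt (by omega)]
    have hGsum : ∀ j, ∑ P ∈ G j, f P = ((#n.support).choose j : ℤ) * sigB 3 j 0 := by
      intro j
      rw [sum_congr rfl fun P hP => (by obtain ⟨hPS, hj⟩ := mem_filter.1 hP; rw [hfB P hPS, hj] : f P = sigB 3 j 0),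
        sum_const, hGcard, nsmul_eq_mul]
    have hdisj : ∀ i j, i ≠ j → Disjoint (G i) (G j) := fun i j hij =>
      disjoint_left.2 fun P h1 h2 => hij ((mem_filter.1 h1).2.symm.trans (mem_filter.1 h2).2)
    have hsub : G 5 ∪ G 6 ∪ G 7 ⊆ S :=
      union_subset (union_subset (filter_subset _ _) (filter_subset _ _)) (filter_subset _ _)
    have hineq : (2 : ℤ) * (#n.support).choose 6 ≤ 4 * (#n.support).choose 5 + 6 * (#n.support).choose 7 := by
      exact_mod_cast two_choose_six_le #n.support
    calc (0 : ℤ) ≤ ((#n.support).choose 5 : ℤ) * sigB 3 5 0 + ((#n.support).choose 6 : ℤ) * sigB 3 6 0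
          + ((#n.support).choose 7 : ℤ) * sigB 3 7 0 := by
          rw [sigB_three_5_0, sigB_three_6_0, sigB_three_7_0]; linarith
      _ = ∑ P ∈ G 5 ∪ G 6 ∪ G 7, f P := by
          rw [sum_union (disjoint_union_left.2 ⟨hdisj 5 7 (by norm_num), hdisj 6 7 (by norm_num)⟩),
            sum_union (hdisj 5 6 (by norm_num)), hGsum, hGsum, hGsum]
      _ ≤ ∑ P ∈ S, f P := by
          refine sum_le_sum_of_subset_of_nonneg hsub fun P hPS hPn => hout P hPS fun hPB => hPn ?_
          have h6 : #n.support - #P = 6 := by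
            obtain ⟨-, hw, -⟩ := hBadP P hPB
            rw [hV1N] at hw
            have := (mem_filter.1 hPB).1
            rw [hV2e, card_empty, add_zero, card_sdiff_of_subset (hSsub P this)] at hw
            exact hw
          exact mem_union_left _ (mem_union_right _ (mem_filter.2 ⟨hPS, h6⟩))
  · -- `n` has a doubled point `y₀`: `P ↦ P.erase y₀` sends negative terms to terms equal to `4`
    have hy₀V1 : y₀ ∉ V₁ := fun h => (mem_sdiff.1 h).2 hy₀
    set φ : Finset α → Finset α := fun P => P.erase y₀ with hφ
    have hφS : ∀ P ∈ Bad, φ P ∈ S := fun P hP =>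
      mem_filter.2 ⟨mem_powerset.2 (subset_univ _),
        (ind_le_iff_subset_support _ n).2 ((erase_subset y₀ P).trans (hSsub P (mem_filter.1 hP).1))⟩
    have hφval : ∀ P ∈ Bad, f (φ P) = 4 := by
      intro P hP
      obtain ⟨hV2P, hw, -⟩ := hBadP P hP
      rw [hfP _ (hφS P hP)]
      have e1 : V₁ \ P.erase y₀ = V₁ \ P := by
        ext i
        simp only [mem_sdiff, mem_erase, not_and]
        constructor
        · rintro ⟨hi, h⟩
          exact ⟨hi, fun hiP => (ne_of_mem_of_not_mem hi hy₀V1) (by_contra fun hne => h hne hiP |>.elim)⟩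
        · rintro ⟨hi, h⟩
          exact ⟨hi, fun _ hiP => h hiP⟩
      have e2 : V₂ ∩ P.erase y₀ = V₂.erase y₀ := by
        ext i
        simp only [mem_inter, mem_erase]
        constructor
        · rintro ⟨hi2, hne, -⟩; exact ⟨hne, hi2⟩
        · rintro ⟨hne, hi2⟩; exact ⟨hi2, hne, hV2P hi2⟩
      have e3 : V₂ \ P.erase y₀ = {y₀} := by
        ext i
        simp only [mem_sdiff, mem_erase, mem_singleton, not_and]
        constructor
        · rintro ⟨hi2, h⟩
          by_contra hne
          exact h hne (hV2P hi2)
        · rintro rfl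
          exact ⟨hy₀, fun hne _ => hne rfl⟩
      have hcard : #(V₁ \ P) + (#V₂ - 1) = 5 := by have := card_pos.2 ⟨y₀, hy₀⟩; omega
      rw [show φ P = P.erase y₀ from rfl, e1, e2, e3, card_erase_of_mem hy₀, card_singleton, hcard, sigB_three_5_1]
    have hsub : Bad ∪ Bad.image φ ⊆ S := union_subset (filter_subset _ _) (image_subset_iff.2 hφS)
    have hdisj : Disjoint Bad (Bad.image φ) := by
      rw [disjoint_left]
      intro P hP hP'
      obtain ⟨Q, -, hQP⟩ := mem_image.1 hP'
      have : y₀ ∈ φ Q := by rw [hQP]; exact (hBadP P hP).1 hy₀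
      exact (notMem_erase y₀ Q) this
    have hinj : Set.InjOn φ ↑Bad := fun P hP Q hQ h =>
      erase_injOn' y₀ (show y₀ ∈ P from (hBadP P (mem_coe.1 hP)).1 hy₀) (show y₀ ∈ Q from (hBadP Q (mem_coe.1 hQ)).1 hy₀) h
    calc (0 : ℤ) ≤ ∑ P ∈ Bad, (f P + f (φ P)) := sum_nonneg fun P hP => by rw [(hBadP P hP).2.2, hφval P hP]; norm_num
      _ = ∑ P ∈ Bad, f P + ∑ P ∈ Bad.image φ, f P := by rw [sum_add_distrib, sum_image hinj]
      _ = ∑ P ∈ Bad ∪ Bad.image φ, f P := (sum_union hdisj).symm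
      _ ≤ ∑ P ∈ S, f P :=
          sum_le_sum_of_subset_of_nonneg hsub fun P hPS hPn => hout P hPS fun hPB => hPn (mem_union_left _ hPB)

end Main

/-! ### Row (a) of the level-3 certificate for every `k`, and the certificate with (a) discharged -/

section RowA

open Literature.Combinatorics.Sahi2008
open Literature.Probability.Percolation (DeterminedBy)

variable {k : ℕ}

/-- **(A3Π) in the shape of `…SahiAllButCPolya`**: `Π·((Π + D₃)·e₃ − Θ₃·D₃) ∈ ℕ[r]` on every finite ground type
(`(Π + D₃)e₃ − Θ₃D₃ = Πe₃ − Θ₂D₃`, `aPolyC_eq`). [this work] -/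
theorem coeff_PiP_mul_aPoly3_nonneg {α : Type*} [DecidableEq α] [Fintype α] (n : α →₀ ℕ) :
    0 ≤ (PiP * ((PiP + DdC 3) * ee 3 - ThC 3 * DdC 3) : MvPolynomial α ℤ).coeff n := by
  have h := aPolyC_eq (α := α) 2
  norm_num at h
  rw [h]
  exact coeff_PiP_mul_X3_nonneg n

/-- **Row (a) of the level-3 threshold certificate at the odds vector of interior parameters, EVERY `k`**:
`Θ₃(r)·D₃(r) ≤ (Π(r) + D₃(r))·e₃(r)`, i.e. `P(N ≤ 2)·P(N ≥ 4) ≤ P(N = 3)` for the number `N` of closed coordinates of any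
product measure on `k` coordinates. [this work] -/
theorem aRow3 {q : Fin k → unitInterval} (hq : ∀ i, 0 < (q i : ℝ) ∧ (q i : ℝ) < 1) :
    ev q (ThC 3) * ev q (DdC 3) ≤ (ev q PiP + ev q (DdC 3)) * ev q (ee 3 : MvPolynomial (Fin k) ℤ) :=
  aRowC_of_coeff_PiP_mul_nonneg (fun n => coeff_PiP_mul_aPoly3_nonneg n) hq

/-- **THE LEVEL-3 THRESHOLD CERTIFICATE, (a) discharged.**  For `k ≥ 3` and interior parameters: if `Ñ₃(K_𝒳,K_𝒵)(r) ≥ 0` for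
all nonempty up-sets `𝒳, 𝒵`, then `ρ₃ = μ(· | exactly three closed)` is a reduced transport certificate of `allBut 3 k = Th_{k−3}^k`.
[this work] -/
theorem rhoCert_allButThree_of_N3 {q : Fin k → unitInterval} (hq : ∀ i, 0 < (q i : ℝ) ∧ (q i : ℝ) < 1) (hk : 3 ≤ k)
    (hN : ∀ 𝒳 𝒵 : Set (Set (Fin k)), IsUpperSet 𝒳 → IsUpperSet 𝒵 → 𝒳.Nonempty → 𝒵.Nonempty → 0 ≤ ev q (Ngen 3 (cx 𝒳) (cx 𝒵))) :
    RhoCert q (allBut 3 k) (rhoC q 3) :=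
  rhoCert_allBut hq hk (aRow3 hq) hN

/-- **KAHN'S CONJECTURE 5 / SAHI'S `C₃` FOR THE LEVEL-3 THRESHOLD FIRST SLOT ("AT LEAST `k − 3` OF `k` OPEN") ON `k` COORDINATES,
CONDITIONAL ONLY ON `Ñ₃ ≥ 0` AT THE ODDS.**  For a block `e : Fin k ↪ ι` (`k ≥ 3`) with interior parameters, an increasing event
`H` determined by the block with pattern event `allBut 3 k` (at most three of the `k` coordinates closed), the (TC) hypothesis
`Ñ₃(K_𝒳,K_𝒵)(r) ≥ 0` for all nonempty up-sets of patterns (the level-3 coefficientwise threshold certificate CTC₃ gives it for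
every `k`; `…SahiCTCN3Five` proves it on five points), and ALL increasing `U, V`: `E₃(1_H, 1_U, 1_V) ≥ 0`.  Row (a) is no longer
a hypothesis. [this work] -/
theorem sahiE_three_nonneg_of_allButThree_of_N3 {ι : Type} [Fintype ι] (p : ι → unitInterval) (e : Fin k ↪ ι) (hk : 3 ≤ k)
    (hp : ∀ i, 0 < (p (e i) : ℝ) ∧ (p (e i) : ℝ) < 1)
    (hN : ∀ 𝒳 𝒵 : Set (Set (Fin k)), IsUpperSet 𝒳 → IsUpperSet 𝒵 → 𝒳.Nonempty → 𝒵.Nonempty →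
      0 ≤ ev (pk e p) (Ngen 3 (cx 𝒳) (cx 𝒵)))
    {H : Set (Set ι)} (hH : DeterminedBy H (Set.range e)) (hpat : pat e H = allBut 3 k) {U V : Set (Set ι)}
    (hU : IsUpperSet U) (hV : IsUpperSet V) :
    0 ≤ sahiE (bernoulliWeight p) 3
      ![Literature.Probability.Percolation.DecisionTree.ind H, Literature.Probability.Percolation.DecisionTree.ind U,
        Literature.Probability.Percolation.DecisionTree.ind V] :=
  sahiE_three_nonneg_of_allBut_of_polya p e hk hp (fun n => coeff_PiP_mul_aPoly3_nonneg n) hN hH hpat hU hV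

end RowA

end SahiAllButC

end Summit.CriticalPhenomena.PercolationContinuityZ3.Theorems
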